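import Mathlib
import HarnessLib
import Summits.NavierStokesRegularity.NavierStokesRegularity.Theorems.PoloidalWindowDoorLrcModEntireTHCertLetters
import Summits.NavierStokesRegularity.NavierStokesRegularity.Theorems.PoloidalWindowDoorPoloidalWindowRigiditySlopeFunctionSource

/-!
# Route `PoloidalWindowDoor`, item `LrcModEntire` (stmt-NavierStokesRegularity-20428) — THE DICTIONARY between the low jet letters of the
# (TH) system and the slice quantities of `stub_localTHEmpty` (wiring, part 1b)

Cell ns-regularity-ideate, seat ns-poloidal-K2-p3 gen 7 (lead of item 20428; `--supports stmt-NavierStokesRegularity-20428`).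
The registered stub speaks of slice derivatives (`fderiv ℝ (u t) y eⱼ i`, `deriv (fun s => u s y 2) t`, `fderiv ℝ (fun y => fderiv ℝ (u t) y e_k 2) y e_j`,
`deriv (fun s => μ s c) t`, `deriv (μ t) c`, `deriv (deriv (μ t)) c`); the certificate checker speaks of the space–time jet letters
`letterFn u μ A ℓ` of `…THCertLetters`.  On the open set `U` where `uncurry u` is analytic (and at whose shadow points `uncurry μ`,
`uncurry A` are analytic) they agree:

* `fderiv_spacetime_spatial`, `deriv_spacetime_time` — space–time derivatives along `(0,e)` / `(1,0)` are slice derivatives;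
* `letterFn_W0`, `letterFn_Wx/Wy/Wz`, `letterFn_Wt` — order ≤ 1 velocity letters;
* `letterFn_W_second` (+ the five instances `letterFn_W2xx, …W2yy, …W2zz, …W2xz, …W2yz`) — second spatial derivatives of `u₂`;
* `letterFn_M00`, `letterFn_M10`, `letterFn_M01`, `letterFn_M02`, `letterFn_A00` — the slope and pressure data and their jets.

WHAT THIS IS NOT: not a claim about Navier–Stokes — wiring (bears_on LADDER-NS N0, item 20428 `stub_localTHEmpty`). [folklore]
-/

noncomputable section

-- the summit and its single sub-problem share the name (CONVENTIONS §1), as in every Theorems file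
set_option linter.dupNamespace false

namespace Summit.NavierStokesRegularity.NavierStokesRegularity.Theorems.PoloidalWindowDoorLrcModEntireTHCertDictionary

open _root_.Topology _root_.Filter Set Function
open Summit.NavierStokesRegularity.NavierStokesRegularity.Theorems.PoloidalWindowDoorLrcModEntireJetLetters
open Summit.NavierStokesRegularity.NavierStokesRegularity.Theorems.PoloidalWindowDoorLrcModEntireTHCertLetters

variable {u : ℝ → EuclideanSpace ℝ (Fin 3) → EuclideanSpace ℝ (Fin 3)} {μ A : ℝ → ℝ → ℝ}
  {U : Set (ℝ × EuclideanSpace ℝ (Fin 3))}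

/-! ### Space–time derivatives versus slice derivatives -/

/-- A space–time derivative along a purely spatial direction is the slice derivative. [folklore] -/
theorem fderiv_spacetime_spatial {F : ℝ × EuclideanSpace ℝ (Fin 3) → ℝ} {p : ℝ × EuclideanSpace ℝ (Fin 3)}
    (hF : DifferentiableAt ℝ F p) (e : EuclideanSpace ℝ (Fin 3)) :
    fderiv ℝ F p (0, e) = fderiv ℝ (fun y => F (p.1, y)) p.2 e := by
  have h := hF.hasFDerivAt.comp p.2 (hasFDerivAt_prodMk_right (𝕜 := ℝ) p.1 p.2)
  rw [show (fun y => F (p.1, y)) = F ∘ (fun y => (p.1, y)) from rfl, h.fderiv]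
  rfl

/-- A space–time derivative along the time direction is the time-line derivative. [folklore] -/
theorem deriv_spacetime_time {F : ℝ × EuclideanSpace ℝ (Fin 3) → ℝ} {p : ℝ × EuclideanSpace ℝ (Fin 3)}
    (hF : DifferentiableAt ℝ F p) : deriv (fun s => F (s, p.2)) p.1 = fderiv ℝ F p (1, 0) := by
  have h := (hF.hasFDerivAt.comp p.1 (hasFDerivAt_prodMk_left (𝕜 := ℝ) p.1 p.2)).hasDerivAt
  rw [show (fun s => F (s, p.2)) = F ∘ (fun s => (s, p.2)) from rfl, h.deriv]
  simp

/-- Slices of an analytic space–time field are differentiable. [folklore] -/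
theorem differentiableAt_slice (hu : AnalyticOnNhd ℝ (uncurry u) U) {p : ℝ × EuclideanSpace ℝ (Fin 3)} (hp : p ∈ U) :
    DifferentiableAt ℝ (u p.1) p.2 := by
  have h := (hu p hp).differentiableAt.comp p.2 (hasFDerivAt_prodMk_right (𝕜 := ℝ) p.1 p.2).differentiableAt
  simpa [Function.comp_def] using h

/-- Components of slice derivatives. [folklore] -/
theorem fderiv_slice_comp (hu : AnalyticOnNhd ℝ (uncurry u) U) {p : ℝ × EuclideanSpace ℝ (Fin 3)} (hp : p ∈ U)
    (e : EuclideanSpace ℝ (Fin 3)) (i : Fin 3) :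
    fderiv ℝ (fun y => u p.1 y i) p.2 e = fderiv ℝ (u p.1) p.2 e i := by
  have h : (fun y => u p.1 y i) = (EuclideanSpace.proj i : EuclideanSpace ℝ (Fin 3) →L[ℝ] ℝ) ∘ u p.1 := rfl
  rw [h, fderiv_comp p.2 (EuclideanSpace.proj i).differentiableAt (differentiableAt_slice hu hp), ContinuousLinearMap.fderiv]
  rfl

/-! ### Velocity letters of order ≤ 1 -/

section Velocity

variable (hu : AnalyticOnNhd ℝ (uncurry u) U)
include hu

omit hu in
/-- `W i 0 0 0 0 = u_i`. [folklore] -/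
theorem letterFn_W0 (i : Fin 3) (p : ℝ × EuclideanSpace ℝ (Fin 3)) : letterFn u μ A (.W i 0 0 0 0) p = u p.1 p.2 i := by
  simp [letterFn, wordW]

/-- `W i 0 1 0 0 = ∂ₓ u_i` as a slice derivative. [folklore] -/
theorem letterFn_Wx (i : Fin 3) {p : ℝ × EuclideanSpace ℝ (Fin 3)} (hp : p ∈ U) :
    letterFn u μ A (.W i 0 1 0 0) p = fderiv ℝ (u p.1) p.2 (EuclideanSpace.single 0 1) i := by
  show jetLetter (fun q : ℝ × EuclideanSpace ℝ (Fin 3) => u q.1 q.2 i) (wordW 0 1 0 0) p = _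
  rw [show wordW 0 1 0 0 = [dirVec 1] by simp [wordW], jetLetter_cons, jetLetter_nil]
  show fderiv ℝ (fun q : ℝ × EuclideanSpace ℝ (Fin 3) => u q.1 q.2 i) p (0, EuclideanSpace.single 0 1) = _
  rw [fderiv_spacetime_spatial (analyticOnNhd_comp hu i p hp).differentiableAt, fderiv_slice_comp hu hp]

/-- `W i 0 0 1 0 = ∂_y u_i`. [folklore] -/
theorem letterFn_Wy (i : Fin 3) {p : ℝ × EuclideanSpace ℝ (Fin 3)} (hp : p ∈ U) :
    letterFn u μ A (.W i 0 0 1 0) p = fderiv ℝ (u p.1) p.2 (EuclideanSpace.single 1 1) i := by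
  show jetLetter (fun q : ℝ × EuclideanSpace ℝ (Fin 3) => u q.1 q.2 i) (wordW 0 0 1 0) p = _
  rw [show wordW 0 0 1 0 = [dirVec 2] by simp [wordW], jetLetter_cons, jetLetter_nil]
  show fderiv ℝ (fun q : ℝ × EuclideanSpace ℝ (Fin 3) => u q.1 q.2 i) p (0, EuclideanSpace.single 1 1) = _
  rw [fderiv_spacetime_spatial (analyticOnNhd_comp hu i p hp).differentiableAt, fderiv_slice_comp hu hp]

/-- `W i 0 0 0 1 = ∂_z u_i`. [folklore] -/
theorem letterFn_Wz (i : Fin 3) {p : ℝ × EuclideanSpace ℝ (Fin 3)} (hp : p ∈ U) :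
    letterFn u μ A (.W i 0 0 0 1) p = fderiv ℝ (u p.1) p.2 (EuclideanSpace.single 2 1) i := by
  show jetLetter (fun q : ℝ × EuclideanSpace ℝ (Fin 3) => u q.1 q.2 i) (wordW 0 0 0 1) p = _
  rw [show wordW 0 0 0 1 = [dirVec 3] by simp [wordW], jetLetter_cons, jetLetter_nil]
  show fderiv ℝ (fun q : ℝ × EuclideanSpace ℝ (Fin 3) => u q.1 q.2 i) p (0, EuclideanSpace.single 2 1) = _
  rw [fderiv_spacetime_spatial (analyticOnNhd_comp hu i p hp).differentiableAt, fderiv_slice_comp hu hp]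

/-- `W i 1 0 0 0 = ∂ₜ u_i` as a time-line derivative. [folklore] -/
theorem letterFn_Wt (i : Fin 3) {p : ℝ × EuclideanSpace ℝ (Fin 3)} (hp : p ∈ U) :
    letterFn u μ A (.W i 1 0 0 0) p = deriv (fun s => u s p.2 i) p.1 := by
  show jetLetter (fun q : ℝ × EuclideanSpace ℝ (Fin 3) => u q.1 q.2 i) (wordW 1 0 0 0) p = _
  rw [show wordW 1 0 0 0 = [dirVec 0] by simp [wordW], jetLetter_cons, jetLetter_nil]
  show fderiv ℝ (fun q : ℝ × EuclideanSpace ℝ (Fin 3) => u q.1 q.2 i) p (1, 0) = _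
  rw [deriv_spacetime_time (analyticOnNhd_comp hu i p hp).differentiableAt]

/-! ### Second spatial derivatives of the vertical velocity -/

/-- **Second spatial letters are iterated slice derivatives**: for spatial directions `eo, ei`,
`jetLetter u₂ [(0,eo), (0,ei)] (t,y) = D(y ↦ D(u t)(y) ei ₂)(y) eo` on `U`. [folklore] -/
theorem letterFn_W_second (hU : IsOpen U) {p : ℝ × EuclideanSpace ℝ (Fin 3)} (hp : p ∈ U) (eo ei : EuclideanSpace ℝ (Fin 3)) :
    jetLetter (fun q : ℝ × EuclideanSpace ℝ (Fin 3) => u q.1 q.2 2) [((0 : ℝ), eo), ((0 : ℝ), ei)] p =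
      fderiv ℝ (fun y => fderiv ℝ (u p.1) y ei 2) p.2 eo := by
  set F : ℝ × EuclideanSpace ℝ (Fin 3) → ℝ := fun q => u q.1 q.2 2 with hF
  have hFa : AnalyticOnNhd ℝ F U := analyticOnNhd_comp hu 2
  -- the inner letter `G = jetLetter F [(0,ei)]` is analytic on `U`, and its slice agrees with `y ↦ D(u t) y ei ₂` near `p.2`
  have hGa : AnalyticOnNhd ℝ (jetLetter F [((0 : ℝ), ei)]) U := analyticOnNhd_jetLetter hFa _
  have hslice : (fun y => fderiv ℝ (u p.1) y ei 2) =ᶠ[𝓝 p.2] fun y => jetLetter F [((0 : ℝ), ei)] (p.1, y) := by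
    have hc : ContinuousAt (fun y : EuclideanSpace ℝ (Fin 3) => ((p.1, y) : ℝ × EuclideanSpace ℝ (Fin 3))) p.2 := by fun_prop
    have hnh : U ∈ 𝓝 ((p.1, p.2) : ℝ × EuclideanSpace ℝ (Fin 3)) := hU.mem_nhds hp
    filter_upwards [hc.preimage_mem_nhds hnh] with y hy
    have hy' : ((p.1, y) : ℝ × EuclideanSpace ℝ (Fin 3)) ∈ U := hy
    show fderiv ℝ (u p.1) y ei 2 = jetLetter F [((0 : ℝ), ei)] (p.1, y)
    rw [jetLetter_cons, jetLetter_nil]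
    show _ = fderiv ℝ F (p.1, y) (0, ei)
    rw [fderiv_spacetime_spatial (p := (p.1, y)) (hFa _ hy').differentiableAt ei]
    exact (fderiv_slice_comp hu hy' ei 2).symm
  show fderiv ℝ (jetLetter F [((0 : ℝ), ei)]) p (0, eo) = fderiv ℝ (fun y => fderiv ℝ (u p.1) y ei 2) p.2 eo
  rw [hslice.fderiv_eq, fderiv_spacetime_spatial (hGa p hp).differentiableAt]

/-- `W 2 0 2 0 0 = ∂ₓ∂ₓ u₂`. [folklore] -/
theorem letterFn_W2xx (hU : IsOpen U) {p : ℝ × EuclideanSpace ℝ (Fin 3)} (hp : p ∈ U) :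
    letterFn u μ A (.W 2 0 2 0 0) p =
      fderiv ℝ (fun y => fderiv ℝ (u p.1) y (EuclideanSpace.single 0 1) 2) p.2 (EuclideanSpace.single 0 1) := by
  show jetLetter (fun q : ℝ × EuclideanSpace ℝ (Fin 3) => u q.1 q.2 2) (wordW 0 2 0 0) p = _
  rw [show wordW 0 2 0 0 = [dirVec 1, dirVec 1] by simp [wordW, List.replicate]]
  exact letterFn_W_second hu hU hp _ _

/-- `W 2 0 0 2 0 = ∂_y∂_y u₂`. [folklore] -/
theorem letterFn_W2yy (hU : IsOpen U) {p : ℝ × EuclideanSpace ℝ (Fin 3)} (hp : p ∈ U) :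
    letterFn u μ A (.W 2 0 0 2 0) p =
      fderiv ℝ (fun y => fderiv ℝ (u p.1) y (EuclideanSpace.single 1 1) 2) p.2 (EuclideanSpace.single 1 1) := by
  show jetLetter (fun q : ℝ × EuclideanSpace ℝ (Fin 3) => u q.1 q.2 2) (wordW 0 0 2 0) p = _
  rw [show wordW 0 0 2 0 = [dirVec 2, dirVec 2] by simp [wordW, List.replicate]]
  exact letterFn_W_second hu hU hp _ _

/-- `W 2 0 0 0 2 = ∂_z∂_z u₂`. [folklore] -/
theorem letterFn_W2zz (hU : IsOpen U) {p : ℝ × EuclideanSpace ℝ (Fin 3)} (hp : p ∈ U) :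
    letterFn u μ A (.W 2 0 0 0 2) p =
      fderiv ℝ (fun y => fderiv ℝ (u p.1) y (EuclideanSpace.single 2 1) 2) p.2 (EuclideanSpace.single 2 1) := by
  show jetLetter (fun q : ℝ × EuclideanSpace ℝ (Fin 3) => u q.1 q.2 2) (wordW 0 0 0 2) p = _
  rw [show wordW 0 0 0 2 = [dirVec 3, dirVec 3] by simp [wordW, List.replicate]]
  exact letterFn_W_second hu hU hp _ _

/-- `W 2 0 1 0 1 = ∂ₓ∂_z u₂` (outer `x`, inner `z` — the twist bracket's letter). [folklore] -/
theorem letterFn_W2xz (hU : IsOpen U) {p : ℝ × EuclideanSpace ℝ (Fin 3)} (hp : p ∈ U) :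
    letterFn u μ A (.W 2 0 1 0 1) p =
      fderiv ℝ (fun y => fderiv ℝ (u p.1) y (EuclideanSpace.single 2 1) 2) p.2 (EuclideanSpace.single 0 1) := by
  show jetLetter (fun q : ℝ × EuclideanSpace ℝ (Fin 3) => u q.1 q.2 2) (wordW 0 1 0 1) p = _
  rw [show wordW 0 1 0 1 = [dirVec 1, dirVec 3] by simp [wordW, List.replicate]]
  exact letterFn_W_second hu hU hp _ _

/-- `W 2 0 0 1 1 = ∂_y∂_z u₂`. [folklore] -/
theorem letterFn_W2yz (hU : IsOpen U) {p : ℝ × EuclideanSpace ℝ (Fin 3)} (hp : p ∈ U) :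
    letterFn u μ A (.W 2 0 0 1 1) p =
      fderiv ℝ (fun y => fderiv ℝ (u p.1) y (EuclideanSpace.single 2 1) 2) p.2 (EuclideanSpace.single 1 1) := by
  show jetLetter (fun q : ℝ × EuclideanSpace ℝ (Fin 3) => u q.1 q.2 2) (wordW 0 0 1 1) p = _
  rw [show wordW 0 0 1 1 = [dirVec 2, dirVec 3] by simp [wordW, List.replicate]]
  exact letterFn_W_second hu hU hp _ _

end Velocity

/-! ### Slope and pressure letters -/

section SlopeData

variable (hμ : ∀ p ∈ U, AnalyticAt ℝ (uncurry μ) (p.1, p.2 2))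
include hμ

omit hμ in
/-- `M 0 0 = μ(t, y₂)`. [folklore] -/
theorem letterFn_M00 (p : ℝ × EuclideanSpace ℝ (Fin 3)) : letterFn u μ A (.M 0 0) p = μ p.1 (p.2 2) := by
  simp [letterFn, word2]

omit hμ in
/-- `A 0 0 = A(t, y₂)`. [folklore] -/
theorem letterFn_A00 (p : ℝ × EuclideanSpace ℝ (Fin 3)) : letterFn u μ A (.A 0 0) p = A p.1 (p.2 2) := by
  simp [letterFn, word2]

/-- `M 1 0 = ∂ₜμ(t, y₂)`. [folklore] -/
theorem letterFn_M10 {p : ℝ × EuclideanSpace ℝ (Fin 3)} (hp : p ∈ U) :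
    letterFn u μ A (.M 1 0) p = deriv (fun s => μ s (p.2 2)) p.1 := by
  show jetLetter (uncurry μ) (word2 1 0) (p.1, p.2 2) = _
  rw [show word2 1 0 = [((1 : ℝ), (0 : ℝ))] by simp [word2], jetLetter_cons, jetLetter_nil]
  exact ((Summit.NavierStokesRegularity.NavierStokesRegularity.Theorems.PoloidalWindowDoorPoloidalWindowRigiditySlopeFunctionSource.hasDerivAt_slices_of_uncurry
    (p := (p.1, p.2 2)) (hμ p hp).differentiableAt).2.deriv).symm

/-- `M 0 1 = ∂_zμ(t, y₂)`. [folklore] -/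
theorem letterFn_M01 {p : ℝ × EuclideanSpace ℝ (Fin 3)} (hp : p ∈ U) :
    letterFn u μ A (.M 0 1) p = deriv (μ p.1) (p.2 2) := by
  show jetLetter (uncurry μ) (word2 0 1) (p.1, p.2 2) = _
  rw [show word2 0 1 = [((0 : ℝ), (1 : ℝ))] by simp [word2], jetLetter_cons, jetLetter_nil]
  exact ((Summit.NavierStokesRegularity.NavierStokesRegularity.Theorems.PoloidalWindowDoorPoloidalWindowRigiditySlopeFunctionSource.hasDerivAt_slices_of_uncurry
    (p := (p.1, p.2 2)) (hμ p hp).differentiableAt).1.deriv).symm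

/-- `M 0 2 = ∂_z²μ(t, y₂)`. [folklore] -/
theorem letterFn_M02 {p : ℝ × EuclideanSpace ℝ (Fin 3)} (hp : p ∈ U) :
    letterFn u μ A (.M 0 2) p = deriv (deriv (μ p.1)) (p.2 2) := by
  show jetLetter (uncurry μ) (word2 0 2) (p.1, p.2 2) = _
  rw [show word2 0 2 = [((0 : ℝ), (1 : ℝ)), ((0 : ℝ), (1 : ℝ))] by simp [word2, List.replicate], jetLetter_cons]
  -- near `p.2 2`, `deriv (μ p.1)` is the slice of the analytic letter `q ↦ D(uncurry μ)(q)(0,1)`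
  set G : ℝ × ℝ → ℝ := fun q => fderiv ℝ (uncurry μ) q (0, 1) with hG
  have hO := isOpen_analyticSet μ
  have hGa : AnalyticOnNhd ℝ G (analyticSet μ) := by
    have := analyticOnNhd_jetLetter (analyticOnNhd_analyticSet μ) [((0 : ℝ), (1 : ℝ))]
    simpa [jetLetter_cons, jetLetter_nil, hG] using this
  have hev : deriv (μ p.1) =ᶠ[𝓝 (p.2 2)] fun c => G (p.1, c) := by
    have hc : ContinuousAt (fun c : ℝ => ((p.1, c) : ℝ × ℝ)) (p.2 2) := by fun_prop
    filter_upwards [hc.preimage_mem_nhds (hO.mem_nhds (hμ p hp))] with c hc'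
    exact (Summit.NavierStokesRegularity.NavierStokesRegularity.Theorems.PoloidalWindowDoorPoloidalWindowRigiditySlopeFunctionSource.hasDerivAt_slices_of_uncurry
      (p := (p.1, c)) (show AnalyticAt ℝ (uncurry μ) (p.1, c) from hc').differentiableAt).1.deriv
  rw [hev.deriv_eq]
  have hGd : DifferentiableAt ℝ (uncurry fun s c => G (s, c)) (p.1, p.2 2) := by
    have e : (uncurry fun s c => G (s, c)) = G := by funext q; rcases q with ⟨s, c⟩; rfl
    rw [e]; exact (hGa _ (hμ p hp)).differentiableAt
  have h := (Summit.NavierStokesRegularity.NavierStokesRegularity.Theorems.PoloidalWindowDoorPoloidalWindowRigiditySlopeFunctionSource.hasDerivAt_slices_of_uncurry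
    (G := fun s c => G (s, c)) (p := (p.1, p.2 2)) hGd).1
  have e : (uncurry fun s c => G (s, c)) = G := by funext q; rcases q with ⟨s, c⟩; rfl
  rw [e] at h
  exact h.deriv.symm

end SlopeData

end Summit.NavierStokesRegularity.NavierStokesRegularity.Theorems.PoloidalWindowDoorLrcModEntireTHCertDictionary

end
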